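import Summits.MatrixMultiplication.OmegaCensus.STPP211Z2pow6Codes

/-!
# (2,1,1)¹⁰ ⊄ (ℤ/2)⁶ — part H1a: the GL normal-form maps of `𝔽₂⁶` (kernel-checked), for the normal-form layer (S3)

Cell `pub-omega` (unit `pub-omega-stpp-1-g36`), topic `Summits/MatrixMultiplication/OmegaCensus`.
HONEST FRAMING (verbatim): lottery ticket; floor = certified bounds/negative ranges. Census STRUCTURE bookkeeping (B5, `T1((ℤ/2)⁶)`, Pb237);
nothing here is a bound on `ω`.

Twin of the `𝔽₂⁵` maps of `STPP211Z2pow5Codes` (seat g35) one dimension up. `u j = dec 2ʲ` (`j < 6`) is the standard basis;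
`phi j v : G6 →+ G6` (any `v`) is additive and injective, and when `2ʲ ≤ enc v` it sends `v ↦ u j` and FIXES every `x` with `enc x < 2ʲ`
(the span of `u 0 … u (j−1)`). On codes (`phiC`): with `i` the top bit of `w = enc v`, `x ↦ swapᵢⱼ(x + xᵢ w) + xᵢ 2ʲ`. The four properties
are `decide`d by the kernel over the `64³` code triples, one theorem per `j` (`phiC_check0 … phiC_check5`). These maps drive the GL descent
of an arbitrary `c`-set `C ∋ 0` to a FRAME NORMAL FORM `{0, u 0, …, u (d−1)} ⊆ C ⊆ span` (`d = dim span C`), the first stage of the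
reduction «any `(2,1,1)¹⁰` family of `(ℤ/2)⁶` ↦ one of the 29 representative `c`-lists» (successor files).

References: H. Cohn, R. Kleinberg, B. Szegedy, C. Umans, FOCS 2005 (arXiv:math/0511460), Def. 5.1.
-/

namespace Summit.MatrixMultiplication.OmegaCensus

namespace T1Z2p6

open Finset

/-- The basis vector with code `2ʲ`. -/
def u (j : ℕ) : G6 := dec (2 ^ j)

/-- Code of a basis vector. -/
theorem enc_u : ∀ j < 6, enc (u j) = 2 ^ j := by decide

/-- `dec` turns XOR of codes (`< 64`) into addition. -/
theorem dec_xor (a : ℕ) (ha : a < 64) (b : ℕ) (hb : b < 64) : dec (Nat.xor a b) = dec a + dec b := by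
  have h := enc_add (dec a) (dec b)
  rw [enc_dec a ha, enc_dec b hb] at h
  rw [← h, dec_enc]

/-! ## The normal-form maps on codes -/

/-- The normal-form map on codes (`w` = code of `v`; identity when `w < 2ʲ` or `w ≥ 64`): with `i = log₂ w`, `y = x + xᵢ w`,
swap bits `i` and `j` of `y` (bit `i` of `y` is `0`) and put `xᵢ` into bit `j`. -/
def phiC (j w x : ℕ) : ℕ :=
  if w < 2 ^ j ∨ 64 ≤ w then x else
    let i := Nat.log2 w
    let y := if x.testBit i then Nat.xor x w else x
    (if y.testBit j then y - 2 ^ j + 2 ^ i else y) + (if x.testBit i then 2 ^ j else 0)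

/-- The normal-form map `x ↦ swapᵢⱼ(x + xᵢ v) + xᵢ uⱼ` as a function on `G6`. -/
def phiFun (j : ℕ) (v x : G6) : G6 := dec (phiC j (enc v) (enc x))

/-- The kernel check of the normal-form map for ONE `j`: additivity for XOR, codes `< 64`, injectivity, `w ↦ 2ʲ` and the lower span
fixed (the last two when `2ʲ ≤ w`), over all codes `w, x, y < 64`. -/
def phiCheck (j : ℕ) : Bool := allC fun w => allC fun x => allC fun y =>
    (phiC j w (Nat.xor x y) == Nat.xor (phiC j w x) (phiC j w y)) && Nat.blt (phiC j w x) 64 &&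
    (!(phiC j w x == phiC j w y) || (x == y)) &&
    (Nat.blt w (2 ^ j) || ((phiC j w w == 2 ^ j) && (!(Nat.blt x (2 ^ j)) || (phiC j w x == x))))

/-- KERNEL CHECK, `j = 0` (64³ code triples). -/ theorem phiC_check0 : phiCheck 0 = true := by decide +kernel
/-- KERNEL CHECK, `j = 1`. -/ theorem phiC_check1 : phiCheck 1 = true := by decide +kernel

end T1Z2p6

end Summit.MatrixMultiplication.OmegaCensus
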